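import Literature.AlgebraicGeometry.Motives.ProjectiveBundleOfQuotientSections
import Literature.AlgebraicGeometry.Modules.DualSectionsEquiv
import Literature.AlgebraicGeometry.Modules.IsoOfSectionsOnBasis
import Literature.AlgebraicGeometry.Modules.LocalFrames
import HarnessLib

/-!
# The `T`-points of `P(G) ↪ X × Gr₁`: the relations of `G` must die in the quotient classified by the `Gr`-component

Topic `AlgebraicGeometry/Motives`; namespace `Literature.AlgebraicGeometry.Motives.Grassmannian.ProjBundle`. THEOREMS ONLY
(no definition, no instance, no notation, no named fact, no `sorry`).

For the incidence subscheme `P(G) = V(u_φ) ↪ X × Gr₁(M)` of an epimorphism `φ : 𝒪_X^{(J)} ↠ G` (★ `Motives/ProjectiveBundleOfQuotient`)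
this file computes its functor of points in the KERNEL-FAMILY currency of the tree's Grassmannian (`pointsEquiv`, `evalAffine`: a
`T`-point `g` of `Gr₁(M)` is, on every affine open `V ⊆ T`, the submodule `ker θ_V ⊆ Γ(T, V) ⊗ M` of the rank-one quotient it
classifies, ★ `ker_sectionsMap_pullback_universalQuotient`): **a morphism `t : T ⟶ X × Gr₁(M)` factors (uniquely) through `P(G)`
iff for every open `W ⊆ X`, every section `s` of `ker φ` over `W` with `ι(s) = Σ_j a_j ε_j`, and every affine open
`V ⊆ (t ≫ pr₁)⁻¹ W`, the element `Σ_j (t ≫ pr₁)♯(a_j)|_V ⊗ b_j` of `Γ(T, V) ⊗ M` lies in the kernel submodule of the point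
`t ≫ pr₂`** (`exists_lift_iff`) — «the relations of `G`, pulled back along `t ≫ pr₁`, die in the rank-one quotient of `𝒪_T ⊗ M`
classified by `t ≫ pr₂`», i.e. that quotient factors through `(t ≫ pr₁)^*G` ([GortzWedhorn2020, (13.8)]: `ℙ(ℰ)(T) = `
line-bundle quotients of `f^*ℰ`; [Hartshorne1977, II Prop. 7.12]).

Road: `t` factors iff `t^* u_φ = 0` (★ `Modules/VanishingLocusOfHom.exists_comp_subschemeι_eq_iff`); a morphism out of
`t^* pr₁^*(ker φ)` vanishes iff it kills all `η_t(η_{pr₁}(s))` (★ `Modules/DualSectionsEquiv.pullback_pullback_hom_ext_unitSection`);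
`u_φ(η_{pr₁} s) = Σ_j pr₁♯(a_j) · η_{pr₂}(q_j)|` (`incidence_app_unitSection`, from the section calculus of
★ `Motives/ProjectiveBundleOfQuotientSections`); transport along `t^* pr₂^* ≅ (t ≫ pr₂)^*` (★ `pullbackComp_hom_app_unitSection`),
restrict to affine opens (★ `eq_zero_of_map_eq_zero_on_basis`) and read the kernel (★ `ker_sectionsMap_pullback_universalQuotient`).

## References
* [Hartshorne1977] R. Hartshorne, *Algebraic Geometry* (1977), II §7 Prop. 7.12; II §5 p. 110.
* [GortzWedhorn2020] U. Görtz, T. Wedhorn, *Algebraic Geometry I*, 2nd ed. (2020), (8.4) (pp. 213–215), (13.8).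
* [Fulton1998] W. Fulton, *Intersection Theory*, 2nd ed. (1998), App. B.3.4, B.5.5.
-/

noncomputable section

set_option backward.isDefEq.respectTransparency false

open CategoryTheory CategoryTheory.Limits Opposite TopologicalSpace AlgebraicGeometry TensorProduct
open Literature.AlgebraicGeometry.Modules

universe u

namespace Literature.AlgebraicGeometry.Motives.Grassmannian

namespace ProjBundle

variable {X : Scheme.{u}} (M : Type u) [AddCommGroup M] {J : Type u} [Fintype J] (b : Module.Basis J ℤ M)
  [(grassmannianSheaf M 1).obj.IsRepresentable] {G : X.Modules} (φ : freeModule X J ⟶ G)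

/-! ## §1 The incidence morphism on pulled-back sections -/

omit [Fintype J] in
/-- Any open of a scheme lies below the preimage of `⊤` (a syntactic form of `le_top` keeping the preimage in the type, so that
restriction maps compose with the pulled-back-section formulas; any proof of the inequality may be used in its place
when matching the statements below, by proof irrelevance). [folklore] -/
private theorem le_preimage_top {S T : Scheme.{u}} (f : T ⟶ S) (U : T.Opens) : U ≤ f ⁻¹ᵁ ⊤ := le_top

omit [Fintype J] in
/-- The tautological section over an open `W'` of `X × Gr` is the restriction of the one over `pr₂⁻¹ ⊤`, and the inverse
free-module identification sends it to the restricted pulled-back tautological section of `Gr`: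
`(𝒪^{(J)} ≅ pr₂^*𝒪_{Gr}^{(J)})(ε_j|_{W'}) = η_{pr₂}(ε_j)|_{W'}`. [cite: Hartshorne1977, II §5 p. 110] -/
theorem pullbackFreeIso_snd_inv_app_freeSectionOn (W' : (X ⨯ grassmannianScheme M 1).Opens) (j : J) :
    (pullbackFreeIso (prod.snd : X ⨯ grassmannianScheme M 1 ⟶ grassmannianScheme M 1) J).inv.app W'
        (freeSectionOn (X ⨯ grassmannianScheme M 1) j W') =
      ((Scheme.Modules.pullback (prod.snd : X ⨯ grassmannianScheme M 1 ⟶ grassmannianScheme M 1)).obj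
          (freeModule (grassmannianScheme M 1) J)).presheaf.map
        (homOfLE (le_preimage_top (prod.snd : X ⨯ grassmannianScheme M 1 ⟶ grassmannianScheme M 1) W')).op
        (unitSection (prod.snd : X ⨯ grassmannianScheme M 1 ⟶ grassmannianScheme M 1)
          (freeModule (grassmannianScheme M 1) J) ⊤ (freeSectionOn (grassmannianScheme M 1) j ⊤)) := by
  rw [← pullbackFreeIso_inv_app_freeSectionOn (prod.snd : X ⨯ grassmannianScheme M 1 ⟶ grassmannianScheme M 1) J j ⊤,
    ← app_presheaf_map, map_freeSectionOn]

/-- **The incidence morphism on a pulled-back relation**: for a section `s` of `ker φ` over `W ⊆ X` with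
`ι(s) = Σ_j a_j ε_j` (`a_j` its coordinates in the tautological frame), `u_φ(η_{pr₁}(s)) = Σ_j pr₁♯(a_j) · η_{pr₂}(q_j)|_{pr₁⁻¹W}`
— the pulled-back universal sections of `Gr₁(M)` weighted by the pulled-back coefficients of the relation.
[cite: Hartshorne1977, II §7 Prop. 7.12] [cite: GortzWedhorn2020, (8.4) (pp. 213–215)] -/
theorem incidence_app_unitSection (W : X.Opens) (s : Γ(kernel φ, W)) :
    (incidence M b φ).app ((prod.fst : X ⨯ grassmannianScheme M 1 ⟶ X) ⁻¹ᵁ W)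
        (unitSection (prod.fst : X ⨯ grassmannianScheme M 1 ⟶ X) (kernel φ) W s) =
      ∑ j, (prod.fst : X ⨯ grassmannianScheme M 1 ⟶ X).app W
          (coord (freeModuleFrame X J W) (𝟙 W) ((kernel.ι φ).app W s) j) •
        ((Scheme.Modules.pullback (prod.snd : X ⨯ grassmannianScheme M 1 ⟶ grassmannianScheme M 1)).obj
            (universalQuotient 1 M b)).presheaf.map
          (homOfLE (le_preimage_top (prod.snd : X ⨯ grassmannianScheme M 1 ⟶ grassmannianScheme M 1)
            ((prod.fst : X ⨯ grassmannianScheme M 1 ⟶ X) ⁻¹ᵁ W))).op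
          (unitSection (prod.snd : X ⨯ grassmannianScheme M 1 ⟶ grassmannianScheme M 1) (universalQuotient 1 M b) ⊤
            (universalQuotientSection 1 M b j)) := by
  -- expand `ι(s)` in the tautological frame and push through the four constituents of `u_φ`
  have hx : (kernel.ι φ).app W s =
      ∑ j, coord (freeModuleFrame X J W) (𝟙 W) ((kernel.ι φ).app W s) j • freeSectionOn X j W := by
    conv_lhs => rw [eq_sum_coord_smul (freeModuleFrame X J W) (𝟙 W) ((kernel.ι φ).app W s)]
    simp only [op_id, CategoryTheory.Functor.map_id, basisSection_freeModuleFrame]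
    rfl
  unfold incidence
  simp only [Scheme.Modules.Hom.comp_app, CategoryTheory.comp_apply]
  rw [pullback_map_app_unitSection]
  conv_lhs => rw [hx, unitSection_sum]
  simp only [unitSection_smul, map_sum, Scheme.Modules.Hom.app_smul]
  refine Finset.sum_congr rfl fun j _ => ?_
  congr 1
  rw [pullbackFreeIso_hom_app_unitSection, pullbackFreeIso_snd_inv_app_freeSectionOn, Scheme.Modules.Hom.app_map_apply,
    pullback_map_app_unitSection, universalQuotientπ_app_top_freeSectionOn]

/-! ## §2 The `T`-points of `P(G)` -/

section Points

variable {T : Scheme.{u}} (t : T ⟶ X ⨯ grassmannianScheme M 1)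

/-- **`t^* u_φ` on the twice-pulled-back relations**: for `s` a section of `ker φ` over `W` with coordinates `a_j`,
`(t^*u_φ)(η_t(η_{pr₁} s)) = Σ_j t♯(pr₁♯ a_j) · η_t(η_{pr₂}(q_j)|_{pr₁⁻¹W})`. [cite: Hartshorne1977, II §7 Prop. 7.12] -/
theorem pullback_incidence_app_unitSection (W : X.Opens) (s : Γ(kernel φ, W)) :
    ((Scheme.Modules.pullback t).map (incidence M b φ)).app
        (t ⁻¹ᵁ ((prod.fst : X ⨯ grassmannianScheme M 1 ⟶ X) ⁻¹ᵁ W))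
        (unitSection t _ ((prod.fst : X ⨯ grassmannianScheme M 1 ⟶ X) ⁻¹ᵁ W)
          (unitSection (prod.fst : X ⨯ grassmannianScheme M 1 ⟶ X) (kernel φ) W s)) =
      ∑ j, t.app ((prod.fst : X ⨯ grassmannianScheme M 1 ⟶ X) ⁻¹ᵁ W)
          ((prod.fst : X ⨯ grassmannianScheme M 1 ⟶ X).app W
            (coord (freeModuleFrame X J W) (𝟙 W) ((kernel.ι φ).app W s) j)) •
        unitSection t _ ((prod.fst : X ⨯ grassmannianScheme M 1 ⟶ X) ⁻¹ᵁ W)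
          (((Scheme.Modules.pullback (prod.snd : X ⨯ grassmannianScheme M 1 ⟶ grassmannianScheme M 1)).obj
              (universalQuotient 1 M b)).presheaf.map
            (homOfLE (le_preimage_top (prod.snd : X ⨯ grassmannianScheme M 1 ⟶ grassmannianScheme M 1)
              ((prod.fst : X ⨯ grassmannianScheme M 1 ⟶ X) ⁻¹ᵁ W))).op
            (unitSection (prod.snd : X ⨯ grassmannianScheme M 1 ⟶ grassmannianScheme M 1) (universalQuotient 1 M b) ⊤
              (universalQuotientSection 1 M b j))) := by
  rw [pullback_map_app_unitSection, incidence_app_unitSection, unitSection_sum]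
  simp only [unitSection_smul]

omit [Fintype J] in
/-- **Transport along `t^* pr₂^* ≅ (t ≫ pr₂)^*`**: the pseudofunctor isomorphism sends `η_t(η_{pr₂}(q_j)|_{pr₁⁻¹W})` to the
restriction of `η_{t ≫ pr₂}(q_j)` (★ `unitSection_map`, ★ `pullbackComp_hom_app_unitSection`). [cite: Hartshorne1977, II §5 p. 110] -/
theorem pullbackComp_hom_app_unitSection_restrict (W : X.Opens) (j : J) :
    ((Scheme.Modules.pullbackComp t (prod.snd : X ⨯ grassmannianScheme M 1 ⟶ grassmannianScheme M 1)).hom.app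
          (universalQuotient 1 M b)).app (t ⁻¹ᵁ ((prod.fst : X ⨯ grassmannianScheme M 1 ⟶ X) ⁻¹ᵁ W))
        (unitSection t _ ((prod.fst : X ⨯ grassmannianScheme M 1 ⟶ X) ⁻¹ᵁ W)
          (((Scheme.Modules.pullback (prod.snd : X ⨯ grassmannianScheme M 1 ⟶ grassmannianScheme M 1)).obj
              (universalQuotient 1 M b)).presheaf.map
            (homOfLE (le_preimage_top (prod.snd : X ⨯ grassmannianScheme M 1 ⟶ grassmannianScheme M 1)
              ((prod.fst : X ⨯ grassmannianScheme M 1 ⟶ X) ⁻¹ᵁ W))).op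
            (unitSection (prod.snd : X ⨯ grassmannianScheme M 1 ⟶ grassmannianScheme M 1) (universalQuotient 1 M b) ⊤
              (universalQuotientSection 1 M b j)))) =
      ((Scheme.Modules.pullback (t ≫ prod.snd)).obj (universalQuotient 1 M b)).presheaf.map
        (homOfLE (le_preimage_top (t ≫ prod.snd) (t ⁻¹ᵁ ((prod.fst : X ⨯ grassmannianScheme M 1 ⟶ X) ⁻¹ᵁ W)))).op
        (unitSection (t ≫ prod.snd) (universalQuotient 1 M b) ⊤ (universalQuotientSection 1 M b j)) := by
  rw [unitSection_map]
  erw [app_presheaf_map ((Scheme.Modules.pullbackComp t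
      (prod.snd : X ⨯ grassmannianScheme M 1 ⟶ grassmannianScheme M 1)).hom.app (universalQuotient 1 M b))
    ((Opens.map t.base).map (homOfLE (le_preimage_top
      (prod.snd : X ⨯ grassmannianScheme M 1 ⟶ grassmannianScheme M 1)
      ((prod.fst : X ⨯ grassmannianScheme M 1 ⟶ X) ⁻¹ᵁ W))))
    (unitSection t _ ((prod.snd : X ⨯ grassmannianScheme M 1 ⟶ grassmannianScheme M 1) ⁻¹ᵁ ⊤)
      (unitSection (prod.snd : X ⨯ grassmannianScheme M 1 ⟶ grassmannianScheme M 1) (universalQuotient 1 M b) ⊤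
        (universalQuotientSection 1 M b j)))]
  erw [pullbackComp_hom_app_unitSection (prod.snd : X ⨯ grassmannianScheme M 1 ⟶ grassmannianScheme M 1)
    (universalQuotient 1 M b) t ⊤ (universalQuotientSection 1 M b j)]
  rfl

variable [Epi φ]

/-- **THE `T`-POINTS OF `P(G)` (kernel form).** A morphism `t : T ⟶ X × Gr₁(M)` factors (uniquely, `P(G) ↪ X × Gr₁(M)` being a
closed immersion) through the incidence subscheme `P(G)` iff for every open `W ⊆ X`, every section `s` of `ker φ` over `W` with
coordinates `a_j` (`ι(s) = Σ_j a_j ε_j`), and every affine open `V ⊆ (t ≫ pr₁)⁻¹W` of `T`, the element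
`Σ_j (t ≫ pr₁)♯(a_j)|_V ⊗ b_j ∈ Γ(T, V) ⊗ M` lies in the kernel submodule `(pointsEquiv (t ≫ pr₂))|_V` of the rank-one quotient of
`𝒪_T ⊗ M` classified by `t ≫ pr₂` — «the relations of `G` die in the quotient»: `ℙ(ℰ)(T)` is the set of line-bundle quotients
of `f^*ℰ`. [cite: GortzWedhorn2020, (13.8) and (8.4) (pp. 213–215)] [cite: Hartshorne1977, II §7 Prop. 7.12] -/
theorem exists_lift_iff (hG : IsFiniteLocallyFree G) :
    (∃ t' : T ⟶ total M b φ, t' ≫ totalι M b φ = t) ↔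
      ∀ (W : X.Opens) (s : Γ(kernel φ, W)) (V : T.Opens) (hV : IsAffineOpen V)
        (hVW : V ≤ (t ≫ prod.fst) ⁻¹ᵁ W),
        (∑ j, (t ≫ prod.fst).appLE W V hVW (coord (freeModuleFrame X J W) (𝟙 W) ((kernel.ι φ).app W s) j) ⊗ₜ[ℤ] b j) ∈
          (evalAffine hV (pointsEquiv M 1 T (t ≫ prod.snd))).toSubmodule := by
  have hK : IsFiniteLocallyFree (kernel φ) :=
    isFiniteLocallyFree_kernel φ (HasRank.isFiniteLocallyFree' (hasRank_freeModule X J)) hG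
  have hVb : IsFiniteLocallyFree ((Scheme.Modules.pullback
      (prod.snd : X ⨯ grassmannianScheme M 1 ⟶ grassmannianScheme M 1)).obj (universalQuotient 1 M b)) :=
    HasRank.isFiniteLocallyFree' (hasRank_pullback _ (hasRank_universalQuotient 1 M b))
  rw [exists_comp_subschemeι_eq_iff (incidence M b φ) t (frameSystemOfIsFiniteLocallyFree hVb)
    (isAffineLocalizing_of_isFiniteLocallyFree (hK.pullback _)) (isAffineLocalizing_dual_of_isFiniteLocallyFree hVb)]
  -- (1) `t^*u = 0` iff `t^*u` kills all `η_t(η_{pr₁} s)`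
  have step1 : (Scheme.Modules.pullback t).map (incidence M b φ) = 0 ↔
      ∀ (W : X.Opens) (s : Γ(kernel φ, W)),
        ((Scheme.Modules.pullback t).map (incidence M b φ)).app
          (t ⁻¹ᵁ ((prod.fst : X ⨯ grassmannianScheme M 1 ⟶ X) ⁻¹ᵁ W))
          (unitSection t _ ((prod.fst : X ⨯ grassmannianScheme M 1 ⟶ X) ⁻¹ᵁ W)
            (unitSection (prod.fst : X ⨯ grassmannianScheme M 1 ⟶ X) (kernel φ) W s)) = 0 := by
    constructor
    · intro h W s
      rw [h, Scheme.Modules.Hom.zero_app]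
      rfl
    · intro h
      exact pullback_pullback_hom_ext_unitSection t (prod.fst : X ⨯ grassmannianScheme M 1 ⟶ X) (M := kernel φ)
        ((Scheme.Modules.pullback t).map (incidence M b φ)) 0
        fun W s => by rw [h W s, Scheme.Modules.Hom.zero_app]; rfl
  rw [step1]
  refine forall_congr' fun W => forall_congr' fun s => ?_
  rw [pullback_incidence_app_unitSection]
  -- (2) transport along the comparison isomorphism `c : t^* pr₂^* 𝒬 ≅ (t ≫ pr₂)^* 𝒬` (injective on sections)
  have hinj : Function.Injective (((Scheme.Modules.pullbackComp t
      (prod.snd : X ⨯ grassmannianScheme M 1 ⟶ grassmannianScheme M 1)).hom.app (universalQuotient 1 M b)).app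
      (t ⁻¹ᵁ ((prod.fst : X ⨯ grassmannianScheme M 1 ⟶ X) ⁻¹ᵁ W))) :=
    KTheory.app_injective_of_mono _ _
  rw [← map_eq_zero_iff _ hinj, map_sum]
  simp only [Scheme.Modules.Hom.app_smul, pullbackComp_hom_app_unitSection_restrict]
  -- (3) the transported element restricted to an open `V ≤ (t ≫ pr₁)⁻¹ W` is the value of the sections map
  have step3 : ∀ (V : T.Opens) (hVW : V ≤ t ⁻¹ᵁ ((prod.fst : X ⨯ grassmannianScheme M 1 ⟶ X) ⁻¹ᵁ W)),
      ((Scheme.Modules.pullback (t ≫ prod.snd)).obj (universalQuotient 1 M b)).presheaf.map (homOfLE hVW).op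
        (∑ j, t.app ((prod.fst : X ⨯ grassmannianScheme M 1 ⟶ X) ⁻¹ᵁ W)
            ((prod.fst : X ⨯ grassmannianScheme M 1 ⟶ X).app W
              (coord (freeModuleFrame X J W) (𝟙 W) ((kernel.ι φ).app W s) j)) •
          ((Scheme.Modules.pullback (t ≫ prod.snd)).obj (universalQuotient 1 M b)).presheaf.map
            (homOfLE (le_preimage_top (t ≫ prod.snd)
              (t ⁻¹ᵁ ((prod.fst : X ⨯ grassmannianScheme M 1 ⟶ X) ⁻¹ᵁ W)))).op
            (unitSection (t ≫ prod.snd) (universalQuotient 1 M b) ⊤ (universalQuotientSection 1 M b j))) =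
        sectionsMap b ((Scheme.Modules.pullback (t ≫ prod.snd)).obj (universalQuotient 1 M b))
          (fun j => unitSection (t ≫ prod.snd) (universalQuotient 1 M b) ⊤ (universalQuotientSection 1 M b j)) V
          (∑ j, (t ≫ prod.fst).appLE W V hVW (coord (freeModuleFrame X J W) (𝟙 W) ((kernel.ι φ).app W s) j) ⊗ₜ[ℤ]
            b j) := by
    intro V hVW
    rw [map_sum, map_sum]
    refine Finset.sum_congr rfl fun j _ => ?_
    rw [Scheme.Modules.map_smul, sectionsMap_tmul, sectionsMap_one_tmul]
    congr 1
    rw [← CategoryTheory.comp_apply, ← Functor.map_comp]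
    rfl
  constructor
  · intro h0 V hV hVW
    rw [← ker_sectionsMap_pullback_universalQuotient 1 M b (t ≫ prod.snd) hV, LinearMap.mem_ker, ← step3 V hVW, h0,
      map_zero]
  · intro h
    refine eq_zero_of_map_eq_zero_on_basis T.isBasis_affineOpens _ fun V hV hVW => ?_
    rw [step3 V hVW, ← LinearMap.mem_ker, ker_sectionsMap_pullback_universalQuotient 1 M b (t ≫ prod.snd) hV]
    exact h V hV hVW

end Points

end ProjBundle

end Literature.AlgebraicGeometry.Motives.Grassmannian

end
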